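import Summits.CriticalPhenomena.PercolationContinuityZ3.Theorems.FK.IsingGibbsStateCLT
import Summits.CriticalPhenomena.PercolationContinuityZ3.Theorems.FK.IsingPositiveFieldCLT
import HarnessLib

/-!
# THE VARIANCE OF THE ISING MAGNETISATION AND THE LAW OF LARGE NUMBERS: `Var(M_n)/|Λ_n| → χ` (Ellis 2006, Lemma V.7.1)
# AND `μ(|M_n/|Λ_n| − m| ≥ ε) ≤ χ/(ε²|Λ_n|)` (quantitative Thm. V.6.1 (c)) BELOW `β_c`, AT `h > 0`, AND AT LOW TEMPERATURE

Claimed R42 (8)(c) in the cell INBOX at 2026-08-28T19:36:24Z by fkp-10a gen 355 (NEW CLAIM #3 of the gen), addressed to coordinator fk-4 gen 279 (seated 18:13Z 2026-08-28 by l.8496; ruling in force R155 l.8501); lineage row FO-10a-g355v (self-suggested), package g355-isinglln, label IL-A.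
Helper file of the `fk-continuity` build cell (bschramm lane; `--supports stmt-CriticalPhenomena-4575`); builds on
p205010 (kernel theorem, internal audit signed; external expert review pending). No definitions, no named facts, no
sorries; standard axioms. UNCONDITIONAL.

Ellis 2006, Lemma V.7.1 (proof after Newman 1980): for the unique state `P_{β,h}` at `(β,h) ∈ 𝒰`,
`σ²(β,h) = lim_{Λ↑ℤ^d} |Λ|^{-1} Var(S_Λ) = Σ_k ⟨Y_0;Y_k⟩_{β,h}`; Thm. V.6.1 (c): the spin per site `S_Λ/|Λ|` obeys a
law of large numbers with limit `m(β,h)`. Here, generically for a positively associated translation-invariant spin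
measure with summable truncated two-point function `γ(z) = Cov(σ_0, σ_z)` (the setting of the companion CLT files):

* `variance_boxSpinSum_eq` — `Var_μ(M_n) = Σ_{x,y∈Λ_n} γ(y − x)`;
* **`tendsto_variance_boxSpinSum_div_card`** — LEMMA V.7.1: `Var_μ(M_n)/|Λ_n| → Σ_z γ(z)`;
* `variance_boxSpinSum_le` — `Var_μ(M_n) ≤ |Λ_n| Σ_z γ(z)` for every `n` (all overlap counts `≤ |Λ_n|`, `γ ≥ 0` by FKG);
* **`measureReal_le_abs_boxSpinAvg_sub_le`** — Chebyshev: `μ(ε ≤ |M_n/|Λ_n| − E σ_0|) ≤ (Σ_z γ(z))/(ε²|Λ_n|)`, and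
  `tendsto_measureReal_le_abs_boxSpinAvg_sub` — the (quantitative, weak) LAW OF LARGE NUMBERS `M_n/|Λ_n| → E σ_0`;
* specialisations: **the free state / every Gibbs state below `β_c`** (`Var(M_n)/|Λ_n| → χ(β)`,
  `μ(ε ≤ |M_n/|Λ_n||) ≤ χ(β)/(ε²|Λ_n|)`), **the plus state at `β > 0`, `h > 0`**
  (`μ(ε ≤ |M_n/|Λ_n| − m(β,h)|) ≤ 4/(βh ε²|Λ_n|)`, by the GHS bound `χ⁺(β,h) ≤ 4/(βh)` of `IsingPositiveFieldCLT`), and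
  **the low-temperature plus state** (`β ≥ ltBeta d`).

## References

* R. S. Ellis, *Entropy, Large Deviations, and Statistical Mechanics*, Springer 2006, Lemma V.7.1, Thm. V.6.1 (c). [Ellis2006]
* C. M. Newman, Comm. Math. Phys. 74 (1980) 119–128, Thm. 2 (D). [Newman1980]
-/

noncomputable section

namespace Summit.CriticalPhenomena.PercolationContinuityZ3.Theorems.FK

namespace IsingCLT

open MeasureTheory ProbabilityTheory Filter Topology Finset
open scoped symmDiff
open Literature.Probability.Percolation Literature.Probability.LatticeModels
open Summit.CriticalPhenomena.PercolationContinuityZ3.Theorems.FK.NewmanCLT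

variable {d : ℕ}

/-! ### The variance of the box magnetisation (generic) -/

section Generic

variable {μ : Measure (SpinConfig (Site d))} [IsProbabilityMeasure μ]

/-- **`Var_μ(M_n) = Σ_{x,y∈Λ_n} Cov_μ(σ_0, σ_{y−x})`** for a translation-invariant spin measure.
[cite: Ellis2006, Lemma V.7.1 (proof)] -/
theorem variance_boxSpinSum_eq (hT : IsTranslationInvariantMeasure μ) (n : ℕ) :
    Var[fun σ => ∑ z ∈ box d n, spinAt z σ; μ] =
      ∑ x ∈ box d n, ∑ y ∈ box d n, cov[spinAt 0, spinAt (y - x); μ] := by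
  rw [← covariance_self (measurable_fieldSum measurable_spinAt (box d n)).aemeasurable]
  exact covariance_blockSum_eq (γ := fun z : Site d => cov[spinAt 0, spinAt z; μ]) measurable_spinAt abs_spinAt_le_one
    (fun x y => covariance_spinAt_eq_of_isTranslationInvariant hT x y) (box d n) (box d n)

/-- **ELLIS 2006, LEMMA V.7.1 — the variance density of the magnetisation is the susceptibility**: for a
translation-invariant spin measure with summable truncated two-point function `γ(z) = Cov(σ_0,σ_z)`,
`Var_μ(M_n)/|Λ_n| → Σ_z γ(z)` along the boxes `Λ_n = [−n,n]^d`. [cite: Ellis2006, Lemma V.7.1; Newman1980, Thm. 2 (D)] -/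
theorem tendsto_variance_boxSpinSum_div_card (hT : IsTranslationInvariantMeasure μ)
    (hsum : Summable fun z : Site d => cov[spinAt 0, spinAt z; μ]) :
    Tendsto (fun n : ℕ => Var[fun σ => ∑ z ∈ box d n, spinAt z σ; μ] / #(box d n)) atTop
      (𝓝 (∑' z : Site d, cov[spinAt 0, spinAt z; μ])) := by
  have heq : (fun n : ℕ => Var[fun σ => ∑ z ∈ box d n, spinAt z σ; μ] / #(box d n)) =
      fun n : ℕ => (∑ x ∈ box d n, ∑ y ∈ box d n, cov[spinAt 0, spinAt (y - x); μ]) / #(box d n) :=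
    funext fun n => by rw [variance_boxSpinSum_eq hT]
  rw [heq]
  exact tendsto_sum_sum_box_div_card_of_summable (fun z : Site d => cov[spinAt 0, spinAt z; μ]) hsum

/-- **`Var_μ(M_n) ≤ |Λ_n| · Σ_z Cov(σ_0,σ_z)`** for every `n` when `μ` is moreover positively associated (every
covariance is `≥ 0` and every overlap count is at most `|Λ_n|`). [cite: Ellis2006, Lemma V.7.1 (proof); Newman1980, (10)] -/
theorem variance_boxSpinSum_le (hPA : IsPositivelyAssociated μ) (hT : IsTranslationInvariantMeasure μ)
    (hsum : Summable fun z : Site d => cov[spinAt 0, spinAt z; μ]) (n : ℕ) :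
    Var[fun σ => ∑ z ∈ box d n, spinAt z σ; μ] ≤ #(box d n) * ∑' z : Site d, cov[spinAt 0, spinAt z; μ] := by
  have h0 : ∀ z : Site d, 0 ≤ cov[spinAt 0, spinAt z; μ] := fun z =>
    covariance_nonneg_of_monotone hPA (spinAt_mono 0) (spinAt_mono z) (measurable_spinAt 0) (measurable_spinAt z)
      ⟨1, abs_spinAt_le_one 0⟩ ⟨1, abs_spinAt_le_one z⟩
  have h := sum_sum_box_div_card_le_tsum (fun z : Site d => cov[spinAt 0, spinAt z; μ]) h0 hsum n
  rw [variance_boxSpinSum_eq hT, ← div_le_iff₀' (card_box_pos d n)]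
  exact h

/-- **CHEBYSHEV / QUANTITATIVE LAW OF LARGE NUMBERS FOR THE MAGNETISATION** (Ellis 2006, Thm. V.6.1 (c), in `L²` form):
for a positively associated translation-invariant spin measure with `χ = Σ_z Cov(σ_0,σ_z) < ∞` and `ε > 0`,
`μ(ε ≤ |M_n/|Λ_n| − E_μ σ_0|) ≤ χ/(ε² |Λ_n|)`. [cite: Ellis2006, Thm. V.6.1 (c) and Lemma V.7.1] -/
theorem measureReal_le_abs_boxSpinAvg_sub_le (hPA : IsPositivelyAssociated μ) (hT : IsTranslationInvariantMeasure μ)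
    (hsum : Summable fun z : Site d => cov[spinAt 0, spinAt z; μ]) (n : ℕ) {ε : ℝ} (hε : 0 < ε) :
    μ.real {σ | ε ≤ |(∑ z ∈ box d n, spinAt z σ) / #(box d n) - ∫ σ', spinAt 0 σ' ∂μ|} ≤
      (∑' z : Site d, cov[spinAt 0, spinAt z; μ]) / (ε ^ 2 * #(box d n)) := by
  have hN : (0 : ℝ) < #(box d n) := card_box_pos d n
  have hmean : ∫ σ', ∑ z ∈ box d n, spinAt z σ' ∂μ = #(box d n) * ∫ σ', spinAt 0 σ' ∂μ := by
    rw [integral_finsetSum _ fun z _ => integrable_of_abs_le (measurable_spinAt z) (abs_spinAt_le_one z)]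
    have hz : ∀ z : Site d, ∫ σ', spinAt z σ' ∂μ = ∫ σ', spinAt 0 σ' ∂μ := fun z => by
      have h := hT z
      conv_lhs => rw [← h]
      rw [integral_map_equiv]
      simp only [spinAt_configShift, sub_self]
    simp only [hz, Finset.sum_const, nsmul_eq_mul]
  have hmem : MemLp (fun σ => ∑ z ∈ box d n, spinAt z σ) 2 μ :=
    memLp_of_abs_le (measurable_fieldSum measurable_spinAt (box d n)) (abs_fieldSum_le abs_spinAt_le_one (box d n)) 2
  have hcheb := meas_ge_le_variance_div_sq hmem (mul_pos hε hN)
  have hset : {σ : SpinConfig (Site d) | ε ≤ |(∑ z ∈ box d n, spinAt z σ) / #(box d n) - ∫ σ', spinAt 0 σ' ∂μ|} =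
      {σ | ε * #(box d n) ≤ |(∑ z ∈ box d n, spinAt z σ) - ∫ σ', ∑ z ∈ box d n, spinAt z σ' ∂μ|} := by
    ext σ
    simp only [Set.mem_setOf_eq]
    rw [hmean, show (∑ z ∈ box d n, spinAt z σ) / #(box d n) - ∫ σ', spinAt 0 σ' ∂μ =
      ((∑ z ∈ box d n, spinAt z σ) - #(box d n) * ∫ σ', spinAt 0 σ' ∂μ) / #(box d n) by field_simp,
      abs_div, abs_of_pos hN, le_div_iff₀ hN]
  rw [hset, measureReal_def]
  refine (ENNReal.toReal_mono ENNReal.ofReal_ne_top hcheb).trans ?_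
  rw [ENNReal.toReal_ofReal (div_nonneg (variance_nonneg _ _) (sq_nonneg _))]
  calc Var[fun σ => ∑ z ∈ box d n, spinAt z σ; μ] / (ε * #(box d n)) ^ 2
      ≤ (#(box d n) * ∑' z : Site d, cov[spinAt 0, spinAt z; μ]) / (ε * #(box d n)) ^ 2 :=
        div_le_div_of_nonneg_right (variance_boxSpinSum_le hPA hT hsum n) (sq_nonneg _)
    _ = (∑' z : Site d, cov[spinAt 0, spinAt z; μ]) / (ε ^ 2 * #(box d n)) := by
        field_simp

/-- **WEAK LAW OF LARGE NUMBERS FOR THE MAGNETISATION** (Ellis 2006, Thm. V.6.1 (c)): under the same hypotheses,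
`μ(ε ≤ |M_n/|Λ_n| − E_μ σ_0|) → 0` for every `ε > 0` (`d ≥ 1`). [cite: Ellis2006, Thm. V.6.1 (c)] -/
theorem tendsto_measureReal_le_abs_boxSpinAvg_sub (hd : 1 ≤ d) (hPA : IsPositivelyAssociated μ)
    (hT : IsTranslationInvariantMeasure μ) (hsum : Summable fun z : Site d => cov[spinAt 0, spinAt z; μ])
    {ε : ℝ} (hε : 0 < ε) :
    Tendsto (fun n : ℕ => μ.real {σ | ε ≤ |(∑ z ∈ box d n, spinAt z σ) / #(box d n) - ∫ σ', spinAt 0 σ' ∂μ|})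
      atTop (𝓝 0) := by
  have hN : Tendsto (fun n : ℕ => (#(box d n) : ℝ)) atTop atTop := by
    have h0 : ∀ n : ℕ, n ≤ #(box d n) := fun n => by
      rw [card_box]; exact (show n ≤ 2 * n + 1 by omega).trans (Nat.le_self_pow (by omega) _)
    exact tendsto_natCast_atTop_atTop.comp (tendsto_atTop_mono h0 tendsto_id)
  have hlim : Tendsto (fun n : ℕ => (∑' z : Site d, cov[spinAt 0, spinAt z; μ]) / (ε ^ 2 * #(box d n))) atTop (𝓝 0) :=
    tendsto_const_nhds.div_atTop (hN.const_mul_atTop (sq_pos_of_pos hε))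
  exact squeeze_zero (fun n => measureReal_nonneg) (fun n => measureReal_le_abs_boxSpinAvg_sub_le hPA hT hsum n hε) hlim

end Generic

/-! ### Below `β_c`: `Var(M_n)/|Λ_n| → χ(β)` and `M_n/|Λ_n| → 0` for every Gibbs state -/

/-- **LEMMA V.7.1 BELOW `β_c`**: for `d ≥ 2`, `0 ≤ β < β_c(d)` and every `μ ∈ 𝒢(β, 0)`,
`Var_μ(M_n)/|Λ_n| → χ(β) = Σ_x ⟨σ_0σ_x⟩_β = (susceptibility d β).toReal`. [cite: Ellis2006, Lemma V.7.1; AizenmanBarskyFernandezJSP1987, Thm. 1] -/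
theorem tendsto_variance_boxSpinSum_div_card_of_mem_isingGibbsMeasures (hd : 2 ≤ d) {β : ℝ} (hβ : 0 ≤ β)
    (hβc : β < criticalBeta d) {μ : Measure (SpinConfig (Site d))} (hμ : μ ∈ isingGibbsMeasures d β 0) :
    haveI := isProbabilityMeasure_of_mem_isingGibbsMeasures hμ
    Tendsto (fun n : ℕ => Var[fun σ => ∑ z ∈ box d n, spinAt z σ; μ] / #(box d n)) atTop
      (𝓝 (susceptibility d β).toReal) := by
  haveI := isProbabilityMeasure_of_mem_isingGibbsMeasures hμ
  have hc := spinCorr_eq_freeCorr_of_lt_criticalBeta hd hβ hβc hμ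
  have hs := summable_twoPointFree_of_lt_criticalBeta hd hβ hβc
  have hcov : ∀ z : Site d, cov[spinAt 0, spinAt z; μ] = twoPointFree d β z := fun z => by
    rw [covariance_spinAt_eq_twoPointFree hβ hc, sub_zero]
  have hsum : Summable fun z : Site d => cov[spinAt 0, spinAt z; μ] := by simp_rw [hcov]; exact hs
  have h := tendsto_variance_boxSpinSum_div_card (isTranslationInvariantMeasure_of_spinCorr_eq_freeCorr hβ le_rfl μ hc) hsum
  simp_rw [hcov, tsum_twoPointFree_eq_toReal_susceptibility hβ hs] at h
  exact h

/-- **LAW OF LARGE NUMBERS BELOW `β_c` (quantitative)**: for `d ≥ 2`, `0 ≤ β < β_c(d)`, every `μ ∈ 𝒢(β,0)`, `ε > 0`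
and every `n`: `μ(ε ≤ |M_n/|Λ_n||) ≤ χ(β)/(ε²|Λ_n|)` (the mean magnetisation is `0`).
[cite: Ellis2006, Thm. V.6.1 (c) and Lemma V.7.1] -/
theorem measureReal_le_abs_boxSpinAvg_le_of_mem_isingGibbsMeasures (hd : 2 ≤ d) {β : ℝ} (hβ : 0 ≤ β)
    (hβc : β < criticalBeta d) {μ : Measure (SpinConfig (Site d))} (hμ : μ ∈ isingGibbsMeasures d β 0) (n : ℕ)
    {ε : ℝ} (hε : 0 < ε) :
    μ.real {σ | ε ≤ |(∑ z ∈ box d n, spinAt z σ) / #(box d n)|} ≤ (susceptibility d β).toReal / (ε ^ 2 * #(box d n)) := by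
  haveI := isProbabilityMeasure_of_mem_isingGibbsMeasures hμ
  have hc := spinCorr_eq_freeCorr_of_lt_criticalBeta hd hβ hβc hμ
  have hs := summable_twoPointFree_of_lt_criticalBeta hd hβ hβc
  have hcov : ∀ z : Site d, cov[spinAt 0, spinAt z; μ] = twoPointFree d β z := fun z => by
    rw [covariance_spinAt_eq_twoPointFree hβ hc, sub_zero]
  have hsum : Summable fun z : Site d => cov[spinAt 0, spinAt z; μ] := by simp_rw [hcov]; exact hs
  have h := measureReal_le_abs_boxSpinAvg_sub_le (isPositivelyAssociated_of_spinCorr_eq_freeCorr hβ le_rfl μ hc)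
    (isTranslationInvariantMeasure_of_spinCorr_eq_freeCorr hβ le_rfl μ hc) hsum n hε
  simp_rw [integral_spinAt_eq_zero hβ hc 0, sub_zero, hcov, tsum_twoPointFree_eq_toReal_susceptibility hβ hs] at h
  exact h

/-! ### Positive field: `μ(ε ≤ |M_n/|Λ_n| − m(β,h)|) ≤ 4/(βh ε² |Λ_n|)` -/

/-- **LAW OF LARGE NUMBERS FOR THE MAGNETISATION IN A POSITIVE FIELD, explicit** (Ellis 2006, Thm. V.6.1 (c) with
the GHS susceptibility bound `χ⁺(β,h) ≤ 4/(βh)` of `IsingPositiveFieldCLT`): for every `d`, `β > 0`, `h > 0`, the plus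
state `μ`, `ε > 0` and every `n`: `μ(ε ≤ |M_n/|Λ_n| − m(β,h)|) ≤ 4/(βh ε²|Λ_n|)`, `m(β,h) = magnetizationInField d β h`.
[cite: Ellis2006, Thm. V.6.1 (c) and Thm. V.7.2 (b)] -/
theorem measureReal_le_abs_boxSpinAvg_sub_le_of_pos_field {β h : ℝ} (hβ : 0 < β) (hh : 0 < h)
    (μ : Measure (SpinConfig (Site d))) [IsProbabilityMeasure μ]
    (hμ : ∀ A : Finset (Site d), spinCorr μ A = plusCorr d β h A) (n : ℕ) {ε : ℝ} (hε : 0 < ε) :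
    μ.real {σ | ε ≤ |(∑ z ∈ box d n, spinAt z σ) / #(box d n) - magnetizationInField d β h|} ≤
      4 / (β * h * (ε ^ 2 * #(box d n))) := by
  have hcov : ∀ z : Site d, cov[spinAt 0, spinAt z; μ] =
      plusCorr d β h ({0} ∆ {z}) - plusCorr d β h {0} * plusCorr d β h {z} := fun z => by
    rw [covariance_spinAt_eq_plusTruncated hβ.le hμ 0 z, sub_zero]
  have hsum : Summable fun z : Site d => cov[spinAt 0, spinAt z; μ] := by
    simp_rw [hcov]; exact summable_plusTruncated_of_pos_field hβ hh
  have hm : magnetizationInField d β h = ∫ σ', spinAt 0 σ' ∂μ := by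
    rw [integral_spinAt_eq_plusCorr hβ.le hμ 0]
    simp only [magnetizationInField, plusCorr, spinProduct_singleton]
  have key := measureReal_le_abs_boxSpinAvg_sub_le (isPositivelyAssociated_of_spinCorr_eq_plusCorr hβ.le h μ hμ)
    (isTranslationInvariantMeasure_of_spinCorr_eq_plusCorr hβ.le hμ) hsum n hε
  simp_rw [hcov] at key
  rw [hm]
  calc μ.real {σ | ε ≤ |(∑ z ∈ box d n, spinAt z σ) / #(box d n) - ∫ σ', spinAt 0 σ' ∂μ|}
      ≤ (∑' z : Site d, (plusCorr d β h ({0} ∆ {z}) - plusCorr d β h {0} * plusCorr d β h {z})) /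
          (ε ^ 2 * #(box d n)) := key
    _ ≤ (4 / (β * h)) / (ε ^ 2 * #(box d n)) :=
        div_le_div_of_nonneg_right (tsum_plusTruncated_le_of_pos_field hβ hh) (by positivity)
    _ = 4 / (β * h * (ε ^ 2 * #(box d n))) := div_div _ _ _

/-! ### Low temperature: `μ(ε ≤ |M_n/|Λ_n| − m*(β)|) ≤ χ⁺(β)/(ε² |Λ_n|)` -/

/-- **LAW OF LARGE NUMBERS FOR THE MAGNETISATION IN THE LOW-TEMPERATURE PLUS PHASE** (Ellis 2006, Thm. V.6.1 (c);
finite susceptibility by Friedli–Velenik 2017, Thm. 5.16): for `d ≥ 2`, `β ≥ ltBeta d`, the plus state `μ` at zero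
field, `ε > 0` and every `n`: `μ(ε ≤ |M_n/|Λ_n| − m*(β)|) ≤ χ⁺(β)/(ε²|Λ_n|)`, `χ⁺(β) = Σ_z ⟨σ_0;σ_z⟩⁺_β`.
[cite: Ellis2006, Thm. V.6.1 (c); FriedliVelenik2017, Thm. 5.16] -/
theorem measureReal_le_abs_boxSpinAvg_sub_le_of_ltBeta_le (hd : 2 ≤ d) {β : ℝ} (hβ : LTContour.ltBeta d ≤ β)
    (μ : Measure (SpinConfig (Site d))) [IsProbabilityMeasure μ]
    (hμ : ∀ A : Finset (Site d), spinCorr μ A = plusCorr d β 0 A) (n : ℕ) {ε : ℝ} (hε : 0 < ε) :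
    μ.real {σ | ε ≤ |(∑ z ∈ box d n, spinAt z σ) / #(box d n) - spontaneousMagnetization d β|} ≤
      (∑' z : Site d, (plusCorr d β 0 ({0} ∆ {z}) - plusCorr d β 0 {0} * plusCorr d β 0 {z})) /
        (ε ^ 2 * #(box d n)) := by
  have hβ0 : 0 ≤ β := by have := LTContour.one_le_ltBeta d; linarith
  have hcov : ∀ z : Site d, cov[spinAt 0, spinAt z; μ] =
      plusCorr d β 0 ({0} ∆ {z}) - plusCorr d β 0 {0} * plusCorr d β 0 {z} := fun z => by
    rw [covariance_spinAt_eq_plusTruncated hβ0 hμ 0 z, sub_zero]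
  have hsum : Summable fun z : Site d => cov[spinAt 0, spinAt z; μ] := by
    simp_rw [hcov]; exact summable_plusTruncated_of_ltBeta_le hd hβ
  have hm : spontaneousMagnetization d β = ∫ σ', spinAt 0 σ' ∂μ := by
    rw [integral_spinAt_eq_plusCorr hβ0 hμ 0, spontaneousMagnetization_eq_plusCorr]
  have key := measureReal_le_abs_boxSpinAvg_sub_le (isPositivelyAssociated_of_spinCorr_eq_plusCorr hβ0 0 μ hμ)
    (isTranslationInvariantMeasure_of_spinCorr_eq_plusCorr hβ0 hμ) hsum n hε
  simp_rw [hcov] at key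
  rw [hm]
  exact key

end IsingCLT

end Summit.CriticalPhenomena.PercolationContinuityZ3.Theorems.FK

end
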